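import Summits.QuantumFields.YangMills.Theorems.BalabanUVNodesN15KingModelPotentialLipschitz

/-!
# Route «BalabanUVNodes» (K4 «SpineRates»), node N15 = NE2 — THE KING-MODEL RUNG, part 9e: HELLMANN–FEYNMAN AT EVERY COUPLING — the dressed effective
# Laplacian `t ↦ Δ_eff(t·w)` is continuously differentiable THROUGHOUT the potential window, with derivative the DRESSED `ψwψ` sandwich
# `a²N^d·(Q(A₀ + tw)⁻¹diag(w)(A₀ + tw)⁻¹Qᵀ)`, and that derivative is exponentially LOCAL uniformly in `t`, `N`, the volume and `m²`

Cell `pub-ymgap`, Track A (D-0062), seat `pub-ymgap-dag-n15-d` (R134 seat, strategy s3, gen 7).  `bears_on: R4∕N15`; `--supports` the K3‴ item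
`SpineGivenEndpointR13` (stmt-QuantumFields-19912).  COUNT-NEUTRAL; 0 `def`.  Imports part 9b (hence 9a: `dressed_blockNorm_le`, `sandwich_mul_diagonal_mul_apply`,
`abs_sum_mul_mul_le_blocks`, `sum_blocks_exp_le`; and 8d ∕ 7c: `fineOpPot_smul`, `hasDerivAt_inv_affine_apply`).

WHAT THIS FILE PROVES (kernel; `a, m² ≥ 0`).  Part 8d proved the envelope identity AT `t = 0` (`hasDerivAt_effLaplacianPot_apply`: `d∕dt|₀Δ_eff(tw) = N^{−d}Σψ_bwψ_{b′}`,
the UNDRESSED minimisers).  Here, for every coupling `t` inside the window `|t|·sup|w| < w₀ < γ_A`: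
* **`hasDerivAt_effLaplacianPot_smul`** — `HasDerivAt (u ↦ Δ_eff(u·w)(b,b′)) (a²N^d·(Q(A₀+tw)⁻¹diag(w)(A₀+tw)⁻¹Qᵀ)(b,b′)) t`: the first variation at a DRESSED
  point is the dressed sandwich (the fine family `A₀ + u·diag(w)` is affine in `u`, so part 7c's resolvent-derivative lemma = King's (4.39)–(4.40) applies at
  every `t`, with the uniform coercivity `γ_A − w₀` of part 9a on both sides `t ± δ`);
* **`dressedSandwich_le`** — the derivative is LOCAL: `|a²N^d·(Q(A₀+w′)⁻¹diag(w)(A₀+w″)⁻¹Qᵀ)(b,b′)| ≤ a²C²K_d(κ∕2)·sup|w|·e^{−(κ∕2)tdist(b,b′)}` for any two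
  potentials `w′, w″ ≥ −w₀` in the gap (the integrand of part 9b's Lipschitz bound, isolated);
* **`deriv_effLaplacianPot_smul_le`** — hence `|d∕dt Δ_eff(tw)(b,b′)| ≤ a²C²K·sup|w|·e^{−(κ∕2)tdist(b,b′)}` uniformly in `t` in the window: the dressed
  Laplacian is `C¹` in the coupling with a uniformly local derivative (the position-space, nonperturbative form of the Spine's holomorphy-in-the-coupling
  station at the level of the effective operators; part 7c did the covariances for perturbations AFFINE in the coupling).

HONEST FRAMING ∕ LIMITS.  King's `A = 0` SCALAR block-spin construction; a potential is NOT a gauge field; real couplings only (no complex extension is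
formalised); the covariance-level derivative for the nonlinear family `t ↦ (Δ_eff(tw) + aL⁻²Q*Q)⁻¹` is not taken here; nothing is Bałaban's
`Δ^{(k)}(U) − Δ^{(k)}(1)` ∕ `C^{(k)}(Λ;U)`; NOT a node discharge; typed 28∕28, discharged count untouched; one finite torus at fixed ε — NOT ℝ⁴ ∕ OS ∕ mass gap
∕ Clay.  Locators: [King1986] CMP **102** (1986): (2.13)–(2.15) p. 653, (4.39) p. 674, (4.40)–(4.41) p. 675 (resolvent derivative); [Dimock2013] Rev. Math.
Phys. **25** (2013) 1330010, App. D L. 29–30.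
-/

noncomputable section

open scoped BigOperators Matrix
open Finset

namespace Summit.QuantumFields.YangMills.BalabanUVNodes.N15.KingModel

open Literature.MathematicalPhysics.QuantumFieldTheory.Balaban1983to89 hiding blockOf
open Literature.MathematicalPhysics.QuantumFieldTheory.Balaban1983to89.QGQInverse (Coercive)
open Literature.MathematicalPhysics.QuantumFieldTheory.Balaban1983to89.B4Sect5Proof (latticeConst latticeConst_nonneg)
open Literature.MathematicalPhysics.QuantumFieldTheory.Balaban1983to89.B5Prop11Plancherel (Tor fine)
open Literature.MathematicalPhysics.QuantumFieldTheory.King1986.Torus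

variable {d : ℕ} {N : ℕ} [NeZero N] {U : Fin (d + 1) → ℕ} [∀ μ, NeZero (U μ)] {a m2 : ℝ}

/-- **THE DRESSED SANDWICH IS LOCAL**: for any two potentials `w′, w″ ≥ −w₀` in the gap and any direction `w` with `sup|w| ≤ w₁`,
`|a²N^{d+1}·(Q(A₀+w′)⁻¹diag(w)(A₀+w″)⁻¹Qᵀ)(b,b′)| ≤ a²·C²·K_{d+1}(κ∕2)·w₁·e^{−(κ∕2)·tdist(b,b′)}` (`C = ctC a w₀ κ (d+1)`) — the integrand of part 9b's Lipschitz
bound. [cite: King1986, (4.39)–(4.41) p.675 (the sandwich; A = 0); Dimock2013, App. D, Lemma 30] -/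
theorem dressedSandwich_le (ha : 0 ≤ a) (hm : 0 ≤ m2) {κ w₀ : ℝ} (hκ0 : 0 < κ) (hκ1 : κ ≤ 1)
    (hgap : w₀ + (2 * ((d + 1 : ℕ) : ℝ) + a) * κ ^ 2 < gamA a (d + 1)) {w' w'' w : Tor (fine N U) → ℝ} (hw' : ∀ x, -w₀ ≤ w' x)
    (hw'' : ∀ x, -w₀ ≤ w'' x) {w₁ : ℝ} (hw : ∀ x, |w x| ≤ w₁) (b b' : Tor U) :
    |a ^ 2 * (N : ℝ) ^ (d + 1) * (Qmat N U * ((fineOpPot N U a ((N : ℝ) ^ 2) m2 w')⁻¹ * Matrix.diagonal w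
        * (fineOpPot N U a ((N : ℝ) ^ 2) m2 w'')⁻¹) * (Qmat N U)ᵀ) b b'|
      ≤ a ^ 2 * ctC a w₀ κ (d + 1) ^ 2 * latticeConst (d + 1) (κ / 2) * w₁ * Real.exp (-(κ / 2 * tdistT U b b')) := by
  set A := fineOpPot N U a ((N : ℝ) ^ 2) m2 w' with hA
  set A' := fineOpPot N U a ((N : ℝ) ^ 2) m2 w'' with hA'
  set C := ctC a w₀ κ (d + 1) with hC
  have hC0 : 0 ≤ C := ctC_nonneg (by exact_mod_cast hgap)
  have hNr : (0 : ℝ) < ((N : ℕ) : ℝ) ^ (d + 1) := pow_pos (Nat.cast_pos.mpr (Nat.pos_of_ne_zero (NeZero.ne N))) _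
  rw [sandwich_mul_diagonal_mul_apply _ _ (fineOpPot_inv_symm _ w'), abs_mul, abs_of_nonneg (by positivity : (0 : ℝ) ≤ a ^ 2 * (N : ℝ) ^ (d + 1))]
  have hblocks := abs_sum_mul_mul_le_blocks (A⁻¹ *ᵥ fun y => Qmat N U b y) (A'⁻¹ *ᵥ fun y => Qmat N U b' y) w hw
  set s := Real.sqrt ((((N : ℕ) : ℝ) ^ (d + 1))⁻¹) with hs
  have hsq : s * s = ((((N : ℕ) : ℝ) ^ (d + 1))⁻¹) := Real.mul_self_sqrt (by positivity)
  have hu : ∀ z : Tor U, Real.sqrt (blkCut z (A⁻¹ *ᵥ fun y => Qmat N U b y) ⬝ᵥ blkCut z (A⁻¹ *ᵥ fun y => Qmat N U b y))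
      ≤ C * Real.exp (-(κ * tdistT U z b)) * s := fun z => by
    rw [hs, ← Qrow_dot_self (N := N) b]
    exact dressed_blockNorm_le ha hm hκ0.le hκ1 hgap hw' z (fun x hx => Qrow_eq_zero_of_ne b hx)
  have hv : ∀ z : Tor U, Real.sqrt (blkCut z (A'⁻¹ *ᵥ fun y => Qmat N U b' y) ⬝ᵥ blkCut z (A'⁻¹ *ᵥ fun y => Qmat N U b' y))
      ≤ C * Real.exp (-(κ * tdistT U z b')) * s := fun z => by
    rw [hs, ← Qrow_dot_self (N := N) b']
    exact dressed_blockNorm_le ha hm hκ0.le hκ1 hgap hw'' z (fun x hx => Qrow_eq_zero_of_ne b' hx)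
  have hsum : ∑ z : Tor U, Real.sqrt (blkCut z (A⁻¹ *ᵥ fun y => Qmat N U b y) ⬝ᵥ blkCut z (A⁻¹ *ᵥ fun y => Qmat N U b y))
        * Real.sqrt (blkCut z (A'⁻¹ *ᵥ fun y => Qmat N U b' y) ⬝ᵥ blkCut z (A'⁻¹ *ᵥ fun y => Qmat N U b' y))
      ≤ C ^ 2 * ((((N : ℕ) : ℝ) ^ (d + 1))⁻¹) * (latticeConst (d + 1) (κ / 2) * Real.exp (-(κ / 2 * tdistT U b b'))) := by
    calc _ ≤ ∑ z : Tor U, (C * Real.exp (-(κ * tdistT U z b)) * s) * (C * Real.exp (-(κ * tdistT U z b')) * s) :=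
          sum_le_sum fun z _ => mul_le_mul (hu z) (hv z) (Real.sqrt_nonneg _) (by positivity)
      _ = C ^ 2 * ((((N : ℕ) : ℝ) ^ (d + 1))⁻¹) * ∑ z : Tor U, Real.exp (-(κ * tdistT U z b)) * Real.exp (-(κ * tdistT U z b')) := by
          rw [mul_sum]; refine sum_congr rfl fun z _ => ?_; rw [← hsq]; ring
      _ ≤ _ := mul_le_mul_of_nonneg_left (sum_blocks_exp_le hκ0 b b') (by positivity)
  have hw₁0 : 0 ≤ w₁ := (abs_nonneg _).trans (hw (site N U b (j0 N)))
  calc a ^ 2 * (N : ℝ) ^ (d + 1) * |∑ x, (A⁻¹ *ᵥ fun y => Qmat N U b y) x * w x * (A'⁻¹ *ᵥ fun y => Qmat N U b' y) x|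
      ≤ a ^ 2 * (N : ℝ) ^ (d + 1) * (w₁ * (C ^ 2 * ((((N : ℕ) : ℝ) ^ (d + 1))⁻¹)
          * (latticeConst (d + 1) (κ / 2) * Real.exp (-(κ / 2 * tdistT U b b'))))) := by
        refine mul_le_mul_of_nonneg_left (hblocks.trans (mul_le_mul_of_nonneg_left hsum hw₁0)) (by positivity)
    _ = _ := by field_simp

/-- **HELLMANN–FEYNMAN AT EVERY COUPLING — the first variation of the dressed effective Laplacian at a DRESSED point.**  For `a, m² ≥ 0`, a direction `w`
with `sup|w| ≤ w₁` and a coupling `t` with `|t|·w₁ < w₀ < γ_A`: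
`HasDerivAt (u ↦ Δ_eff(u·w)(b,b′)) (a²N^{d+1}·(Q(A₀+tw)⁻¹diag(w)(A₀+tw)⁻¹Qᵀ)(b,b′)) t` — part 8d's envelope identity away from `t = 0` (the value is the
expectation `N^{−d}Σψ^t_bwψ^t_{b′}` of `w` in the DRESSED minimisers).  Mechanism: `A₀ + u·diag(w)` is affine in `u` (8d `fineOpPot_smul`); part 7c's
`hasDerivAt_inv_affine_apply` (King's (4.39)–(4.40)) at `t` with the uniform coercivity `γ_A − w₀` (9a `fineOpPot_coercive_of_ge`) at `t ± δ`.
[cite: King1986, (2.13)–(2.15) p.653, (4.39) p.674, (4.40) p.675; Dimock2013, App. D, Lemma 29] -/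
theorem hasDerivAt_effLaplacianPot_smul (ha : 0 ≤ a) (hm : 0 ≤ m2) {w : Tor (fine N U) → ℝ} {w₀ w₁ t : ℝ} (hw : ∀ x, |w x| ≤ w₁)
    (ht : |t| * w₁ < w₀) (hw₀ : w₀ < gamA a (d + 1)) (b b' : Tor U) :
    HasDerivAt (fun u : ℝ => effLaplacianPot N U a ((N : ℝ) ^ 2) m2 (u • w) b b')
      (a ^ 2 * (N : ℝ) ^ (d + 1) * (Qmat N U * ((fineOpPot N U a ((N : ℝ) ^ 2) m2 (t • w))⁻¹ * Matrix.diagonal w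
        * (fineOpPot N U a ((N : ℝ) ^ 2) m2 (t • w))⁻¹) * (Qmat N U)ᵀ) b b') t := by
  set A := fineOp N U a ((N : ℝ) ^ 2) m2 with hA
  set D := Matrix.diagonal w with hD
  set Q := Qmat N U with hQ
  have hw₁0 : 0 ≤ w₁ := (abs_nonneg _).trans (hw (site N U b (j0 N)))
  -- a step `δ` keeping `t ± δ` inside the window
  set δ : ℝ := (w₀ - |t| * w₁) / (2 * (w₁ + 1)) with hδ
  have hδ0 : 0 < δ := by rw [hδ]; exact div_pos (by linarith) (by positivity)
  have hδw : δ * w₁ ≤ (w₀ - |t| * w₁) / 2 := by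
    rw [hδ, div_mul_eq_mul_div, div_le_div_iff₀ (by positivity) (by norm_num)]
    nlinarith
  have hγ : 0 < gamA a (d + 1) - w₀ := sub_pos.mpr hw₀
  have hcoer : ∀ u : ℝ, |u| ≤ |t| + δ → Coercive (A + u • D) (gamA a (d + 1) - w₀) := by
    intro u hu
    have hlo : ∀ x, -w₀ ≤ (u • w) x := by
      intro x
      rw [Pi.smul_apply, smul_eq_mul]
      have h1 : |u * w x| ≤ (|t| + δ) * w₁ := by
        rw [abs_mul]; exact mul_le_mul hu (hw x) (abs_nonneg _) (by positivity)
      have h2 : (|t| + δ) * w₁ ≤ w₀ := by nlinarith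
      linarith [(abs_le.mp (h1.trans h2)).1]
    have h := fineOpPot_coercive_of_ge (N := N) (U := U) (m2 := m2) ha hm hlo
    rwa [fineOpPot_smul] at h
  have hp : Coercive (A + (t + δ) • D) (gamA a (d + 1) - w₀) :=
    hcoer (t + δ) ((abs_add_le t δ).trans (by rw [abs_of_pos hδ0]))
  have hmn : Coercive (A + (t - δ) • D) (gamA a (d + 1) - w₀) :=
    hcoer (t - δ) ((abs_sub t δ).trans (by rw [abs_of_pos hδ0]))
  have hinv : ∀ x y, HasDerivAt (fun u : ℝ => (A + u • D)⁻¹ x y) (-(((A + t • D)⁻¹ * D * (A + t • D)⁻¹) x y)) t :=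
    fun x y => hasDerivAt_inv_affine_apply hγ hδ0 hp hmn x y
  have hfun : (fun u : ℝ => effLaplacianPot N U a ((N : ℝ) ^ 2) m2 (u • w) b b')
      = fun u : ℝ => a * (1 : Matrix (Tor U) (Tor U) ℝ) b b' - (a ^ 2 * (N : ℝ) ^ (d + 1)) * ∑ y, ∑ x, Q b x * (A + u • D)⁻¹ x y * Q b' y := by
    funext u
    rw [effLaplacianPot, fineOpPot_smul, Matrix.sub_apply, Matrix.smul_apply, Matrix.smul_apply, smul_eq_mul, smul_eq_mul, sandwich_apply]
  rw [hfun]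
  have hsum : HasDerivAt (fun u : ℝ => ∑ y, ∑ x, Q b x * (A + u • D)⁻¹ x y * Q b' y)
      (∑ y, ∑ x, Q b x * (-(((A + t • D)⁻¹ * D * (A + t • D)⁻¹) x y)) * Q b' y) t := by
    apply HasDerivAt.fun_sum; intro y _
    apply HasDerivAt.fun_sum; intro x _
    exact ((hinv x y).const_mul (Q b x)).mul_const (Q b' y)
  have hall := (hsum.const_mul (a ^ 2 * (N : ℝ) ^ (d + 1))).const_sub (a * (1 : Matrix (Tor U) (Tor U) ℝ) b b')
  refine hall.congr_deriv ?_
  rw [fineOpPot_smul, ← hA, ← hD, sandwich_apply]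
  simp only [mul_neg, neg_mul, sum_neg_distrib, neg_neg]
  rfl

/-- **THE DERIVATIVE IN THE COUPLING IS UNIFORMLY LOCAL THROUGHOUT THE WINDOW**: with `0 < κ ≤ 1` and the gap `w₀ + (2d + a)κ² < γ_A`, for every `t`
with `|t|·sup|w| < w₀`:  `|d∕dt Δ_eff(tw)(b,b′)| ≤ a²·C²·K_{d+1}(κ∕2)·sup|w|·e^{−(κ∕2)·tdist(b,b′)}` — the dressed Laplacian is `C¹` in the coupling with
an exponentially local derivative, uniformly in `t`, `N`, the torus and `m²`. [cite: King1986, (4.39)–(4.41) p.675; Dimock2013, App. D, Lemma 30] -/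
theorem deriv_effLaplacianPot_smul_le (ha : 0 ≤ a) (hm : 0 ≤ m2) {κ w₀ : ℝ} (hκ0 : 0 < κ) (hκ1 : κ ≤ 1)
    (hgap : w₀ + (2 * ((d + 1 : ℕ) : ℝ) + a) * κ ^ 2 < gamA a (d + 1)) {w : Tor (fine N U) → ℝ} {w₁ t : ℝ} (hw : ∀ x, |w x| ≤ w₁)
    (ht : |t| * w₁ < w₀) (b b' : Tor U) :
    |deriv (fun u : ℝ => effLaplacianPot N U a ((N : ℝ) ^ 2) m2 (u • w) b b') t|
      ≤ a ^ 2 * ctC a w₀ κ (d + 1) ^ 2 * latticeConst (d + 1) (κ / 2) * w₁ * Real.exp (-(κ / 2 * tdistT U b b')) := by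
  have hw₀ : w₀ < gamA a (d + 1) := by
    have : 0 ≤ (2 * ((d + 1 : ℕ) : ℝ) + a) * κ ^ 2 := by positivity
    linarith
  rw [(hasDerivAt_effLaplacianPot_smul ha hm hw ht hw₀ b b').deriv]
  have hlo : ∀ x, -w₀ ≤ (t • w) x := by
    intro x
    rw [Pi.smul_apply, smul_eq_mul]
    have h1 : |t * w x| ≤ |t| * w₁ := by rw [abs_mul]; exact mul_le_mul_of_nonneg_left (hw x) (abs_nonneg t)
    linarith [(abs_le.mp (h1.trans ht.le)).1]
  exact dressedSandwich_le ha hm hκ0 hκ1 hgap hlo hlo hw b b'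

end Summit.QuantumFields.YangMills.BalabanUVNodes.N15.KingModel

end
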